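import Summits.KontsevichZagierPeriods.KontsevichZagierPeriods.Theorems.HyperbolicBlochOffTetraSectorKernelPolytopeEnvelopeCore
import Summits.KontsevichZagierPeriods.KontsevichZagierPeriods.Theorems.HyperbolicBlochOffTetraSectorKernelPolytopeEnvelopeBoxed
import Summits.KontsevichZagierPeriods.KontsevichZagierPeriods.Theorems.HyperbolicBlochOffTetraSectorKernelPolytopeEnvelopePartition

/-!
# STUB `stub_polytopeEnvelope` — crux `OffTetraSectorKernel`, line `odd-hyperbolic-ladder` (skeleton v5, lead c3)

**Every representation of the volume of a finite-volume `ℚ̄`-geodesic polytope of `ℍ³` is, modulo the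
Kontsevich–Zagier moves, a `ℤ`-combination of ideal-tetrahedron classes.** With the envelope principle this is
`rungTwo_le : closure (rungRelators 2) ≤ relations ⊔ closure (tetrahedral value-relators)` — rung 2 of Goncharov's
hyperbolic scissors ladder IS the Bloch–Wigner sector (Dupont–Sah's "ideal simplices generate P(H̄³)", polytope half,
inside the calculus). Ingredients: normal form in the paraboloid lift, floor candidates, floor divergence /
clearance, mesh of ideal tetrahedra, simplex cuts (the six registered v5 stubs, all hypotheses here), the cusp
transport and floor-freeness (`…PolytopeEnvelopeCusp/Floor/Boxed`), the partition (`…Partition`), and lead c2's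
`simplex_mem_envelope` (via `polyEnv_of_pieces`, `…Core`).

References: J. L. Dupont, C.-H. Sah, *Scissors congruences II* (1982), §3; M. Kontsevich, D. Zagier, *Periods*
(2001), §1.2.
-/

noncomputable section

open Set MeasureTheory
open Literature.NumberTheory.Transcendental Literature.ModelTheory.ExponentialFields

namespace Summit.KontsevichZagierPeriods.HyperbolicBloch.OffTetraSectorKernel

section Assembly

variable (Ql : (Fin 3 → ℝ) → Fin 4 → ℝ) (hQl : ∀ p, Ql p = ![p 0 ^ 2 + p 1 ^ 2 + p 2 ^ 2, p 0, p 1, 1])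
  (Spx : (Fin 4 → Fin 4 → ℝ) → Set (Fin 3 → ℝ))
  (hSpx : ∀ v, Spx v = {p | 0 < p 2 ∧ ∀ a, 0 < (Matrix.of v).det * ((Matrix.of v).updateRow a (Ql p)).det})
  (ρ₀ : ℂ → KZ.IntegralRep 3)
  (hρ₀ : ∀ z, IsAlgebraic ℚ z → 0 < z.im →
    (ρ₀ z).domain = idealTetrahedron z ∧ EqOn (ρ₀ z).integrand (fun p => 1 / p 2 ^ 3) (idealTetrahedron z))
  (hMesh : ∀ (M δ : ℝ), 0 < M → 0 < δ →
    ∃ (m : ℕ) (vs : Fin m → Fin 4 → Fin 4 → ℝ),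
      (∀ j, (∀ i c, IsAlgebraic ℚ (vs j i c)) ∧
        (∀ i, vs j i 1 ^ 2 + vs j i 2 ^ 2 = vs j i 0 * vs j i 3 ∧ 0 ≤ vs j i 3 ∧ 0 < vs j i 0 + vs j i 3) ∧
        (Matrix.of (vs j)).det ≠ 0) ∧
      (∀ j j', j ≠ j' → Spx (vs j) ∩ Spx (vs j') = ∅) ∧
      volume ({p : Fin 3 → ℝ | p 0 ^ 2 + p 1 ^ 2 < M ^ 2 ∧ δ < p 2} \ ⋃ j, Spx (vs j)) = 0)
  (hCut : ∀ (v : Fin 4 → Fin 4 → ℝ), ((∀ i c, IsAlgebraic ℚ (v i c)) ∧ (∀ i, (v i 1 ^ 2 + v i 2 ^ 2 = v i 0 * v i 3 ∧ 0 ≤ v i 3 ∧ 0 < v i 0 + v i 3) ∨ ∃ q : Fin 3 → ℝ, (∀ c, IsAlgebraic ℚ (q c)) ∧ 0 < q 2 ∧ v i = Ql q) ∧ (Matrix.of v).det ≠ 0) →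
    ∀ (m : Fin 4 → ℝ), (∀ c, IsAlgebraic ℚ (m c)) →
    ∃ (N : ℕ) (ws : Fin N → Fin 4 → Fin 4 → ℝ),
      (∀ j, (∀ i c, IsAlgebraic ℚ (ws j i c)) ∧ (∀ i, (ws j i 1 ^ 2 + ws j i 2 ^ 2 = ws j i 0 * ws j i 3 ∧ 0 ≤ ws j i 3 ∧ 0 < ws j i 0 + ws j i 3) ∨ ∃ q : Fin 3 → ℝ, (∀ c, IsAlgebraic ℚ (q c)) ∧ 0 < q 2 ∧ ws j i = Ql q) ∧ (Matrix.of (ws j)).det ≠ 0) ∧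
      (∀ j, Spx (ws j) ⊆ Spx v ∩ {p | 0 < ∑ c, m c * Ql p c}) ∧
      (∀ j j', j ≠ j' → Spx (ws j) ∩ Spx (ws j') = ∅) ∧
      volume ((Spx v ∩ {p | 0 < ∑ c, m c * Ql p c}) \ ⋃ j, Spx (ws j)) = 0)
include hQl hSpx hρ₀ hMesh hCut

/-- **A boxed normal-form piece lies in the envelope**: mesh the box (`stub_meshCover`), cut every mesh simplex by
the constraints (`stub_simplexCut`, iterated), and put every final simplex class in the envelope
(`polyEnv_of_pieces`). [cite: DupontSah1982, §3] -/
theorem polyEnv_box_mem (K : ℕ) (ms : Fin K → Fin 4 → ℝ) (hms : ∀ l c, IsAlgebraic ℚ (ms l c))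
    (Q : Set (Fin 3 → ℝ)) (hQ : Q = {p | 0 < p 2 ∧ ∀ l, 0 < ∑ c, ms l c * Ql p c}) (M δ : ℝ) (hM : 0 < M)
    (hδ : 0 < δ) (hbox : Q ⊆ {p | p 0 ^ 2 + p 1 ^ 2 < M ^ 2 ∧ δ < p 2}) (rq : KZ.IntegralRep 3)
    (hrq : rq.domain = Q) (hrqi : EqOn rq.integrand (fun p => 1 / p 2 ^ 3) Q) :
    KZ.of rq ∈ AddSubgroup.closure {x : KZ.FormalRep | ∃ (k : ℕ) (z : Fin k → ℂ) (e : Fin k → ℤ),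
      (∀ i, IsAlgebraic ℚ (z i)) ∧ (∀ i, 0 < (z i).im) ∧ x - ∑ i, e i • KZ.of (ρ₀ (z i)) ∈ KZ.relations} := by
  have hMesh' : ∀ (M δ : ℝ), 0 < M → 0 < δ → ∃ (m : ℕ) (vs : Fin m → Fin 4 → Fin 4 → ℝ),
      (∀ j, (fun v : Fin 4 → Fin 4 → ℝ => (∀ i c, IsAlgebraic ℚ (v i c)) ∧
        (∀ i, (v i 1 ^ 2 + v i 2 ^ 2 = v i 0 * v i 3 ∧ 0 ≤ v i 3 ∧ 0 < v i 0 + v i 3) ∨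
          ∃ q : Fin 3 → ℝ, (∀ c, IsAlgebraic ℚ (q c)) ∧ 0 < q 2 ∧ v i = Ql q) ∧ (Matrix.of v).det ≠ 0) (vs j)) ∧
      (∀ j, Spx (vs j) ⊆ {p | 0 < p 2}) ∧ (∀ j j', j ≠ j' → Spx (vs j) ∩ Spx (vs j') = ∅) ∧
      volume ({p : Fin 3 → ℝ | p 0 ^ 2 + p 1 ^ 2 < M ^ 2 ∧ δ < p 2} \ ⋃ j, Spx (vs j)) = 0 := by
    intro M δ hM hδ
    obtain ⟨m, vs, hadm, hdisj, hcov⟩ := hMesh M δ hM hδ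
    refine ⟨m, vs, fun j => ⟨(hadm j).1, fun i => Or.inl ((hadm j).2.1 i), (hadm j).2.2⟩, fun j p hp => ?_,
      hdisj, hcov⟩
    rw [hSpx] at hp
    exact hp.1
  have hQ' : Q = {p | 0 < p 2 ∧ ∀ l, p ∈ (fun m : Fin 4 → ℝ => {p : Fin 3 → ℝ | 0 < ∑ c, m c * Ql p c}) (ms l)} := by
    rw [hQ]
    rfl
  obtain ⟨N, ws, hadm, hsub, hdisj, hcov⟩ := polyEnv_meshPieces Spx
    (fun v : Fin 4 → Fin 4 → ℝ => (∀ i c, IsAlgebraic ℚ (v i c)) ∧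
      (∀ i, (v i 1 ^ 2 + v i 2 ^ 2 = v i 0 * v i 3 ∧ 0 ≤ v i 3 ∧ 0 < v i 0 + v i 3) ∨
        ∃ q : Fin 3 → ℝ, (∀ c, IsAlgebraic ℚ (q c)) ∧ 0 < q 2 ∧ v i = Ql q) ∧ (Matrix.of v).det ≠ 0)
    (fun m : Fin 4 → ℝ => {p : Fin 3 → ℝ | 0 < ∑ c, m c * Ql p c}) hCut hMesh' K ms hms Q hQ' M δ hM hδ hbox
  refine polyEnv_of_pieces Ql hQl Spx hSpx ρ₀ hρ₀ rq (by rw [hrq]; exact hrqi) N ws hadm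
    (fun j => by rw [hrq]; exact hsub j) hdisj (by rw [hrq]; exact hcov)

end Assembly

section Assembly2

variable (Ql : (Fin 3 → ℝ) → Fin 4 → ℝ) (hQl : ∀ p, Ql p = ![p 0 ^ 2 + p 1 ^ 2 + p 2 ^ 2, p 0, p 1, 1])
  (Spx : (Fin 4 → Fin 4 → ℝ) → Set (Fin 3 → ℝ))
  (hSpx : ∀ v, Spx v = {p | 0 < p 2 ∧ ∀ a, 0 < (Matrix.of v).det * ((Matrix.of v).updateRow a (Ql p)).det})
  (ρ₀ : ℂ → KZ.IntegralRep 3)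
  (hρ₀ : ∀ z, IsAlgebraic ℚ z → 0 < z.im →
    (ρ₀ z).domain = idealTetrahedron z ∧ EqOn (ρ₀ z).integrand (fun p => 1 / p 2 ^ 3) (idealTetrahedron z))
  (hClear : ∀ (k : ℕ) (L : Fin k → Fin 4 → ℝ) (P : Set (Fin 3 → ℝ)),
      P = {p | 0 < p 2 ∧ ∀ i, 0 < ∑ c, L i c * Ql p c} → P.Nonempty →
      (∀ i, ∃ p : Fin 3 → ℝ, 0 < p 2 ∧ ∑ c, L i c * Ql p c < 0) →
      IntegrableOn (fun p : Fin 3 → ℝ => 1 / p 2 ^ 3) P →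
      (∃ M : ℝ, ∀ p ∈ P, p 0 ^ 2 + p 1 ^ 2 < M ^ 2) ∧
      (∀ η : ℝ, 0 < η → ∃ δ : ℝ, 0 < δ ∧ ∀ p ∈ P, p 2 < δ → ∃ n : Fin 2 → ℝ,
        (∃ i j, i ≠ j ∧ L i 0 * (n 0 ^ 2 + n 1 ^ 2) + L i 1 * n 0 + L i 2 * n 1 + L i 3 = 0 ∧
            L j 0 * (n 0 ^ 2 + n 1 ^ 2) + L j 1 * n 0 + L j 2 * n 1 + L j 3 = 0) ∧
        (p 0 - n 0) ^ 2 + (p 1 - n 1) ^ 2 < η ^ 2))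
  (hMesh : ∀ (M δ : ℝ), 0 < M → 0 < δ →
    ∃ (m : ℕ) (vs : Fin m → Fin 4 → Fin 4 → ℝ),
      (∀ j, (∀ i c, IsAlgebraic ℚ (vs j i c)) ∧
        (∀ i, vs j i 1 ^ 2 + vs j i 2 ^ 2 = vs j i 0 * vs j i 3 ∧ 0 ≤ vs j i 3 ∧ 0 < vs j i 0 + vs j i 3) ∧
        (Matrix.of (vs j)).det ≠ 0) ∧
      (∀ j j', j ≠ j' → Spx (vs j) ∩ Spx (vs j') = ∅) ∧
      volume ({p : Fin 3 → ℝ | p 0 ^ 2 + p 1 ^ 2 < M ^ 2 ∧ δ < p 2} \ ⋃ j, Spx (vs j)) = 0)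
  (hCut : ∀ (v : Fin 4 → Fin 4 → ℝ), ((∀ i c, IsAlgebraic ℚ (v i c)) ∧ (∀ i, (v i 1 ^ 2 + v i 2 ^ 2 = v i 0 * v i 3 ∧ 0 ≤ v i 3 ∧ 0 < v i 0 + v i 3) ∨ ∃ q : Fin 3 → ℝ, (∀ c, IsAlgebraic ℚ (q c)) ∧ 0 < q 2 ∧ v i = Ql q) ∧ (Matrix.of v).det ≠ 0) →
    ∀ (m : Fin 4 → ℝ), (∀ c, IsAlgebraic ℚ (m c)) →
    ∃ (N : ℕ) (ws : Fin N → Fin 4 → Fin 4 → ℝ),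
      (∀ j, (∀ i c, IsAlgebraic ℚ (ws j i c)) ∧ (∀ i, (ws j i 1 ^ 2 + ws j i 2 ^ 2 = ws j i 0 * ws j i 3 ∧ 0 ≤ ws j i 3 ∧ 0 < ws j i 0 + ws j i 3) ∨ ∃ q : Fin 3 → ℝ, (∀ c, IsAlgebraic ℚ (q c)) ∧ 0 < q 2 ∧ ws j i = Ql q) ∧ (Matrix.of (ws j)).det ≠ 0) ∧
      (∀ j, Spx (ws j) ⊆ Spx v ∩ {p | 0 < ∑ c, m c * Ql p c}) ∧
      (∀ j j', j ≠ j' → Spx (ws j) ∩ Spx (ws j') = ∅) ∧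
      volume ((Spx v ∩ {p | 0 < ∑ c, m c * Ql p c}) \ ⋃ j, Spx (ws j)) = 0)
include hQl hSpx hρ₀ hClear hMesh hCut

/-- **A cusp piece lies in the envelope.** Transport `[r|P ∩ ball((n,0),ρ)]` to the cusp at `∞` (landed moves,
`polyEnv_transport`); the image is boxed with an explicit algebraic normal form (`polyEnv_image_boxed`); boxed
normal-form pieces are in the envelope (`polyEnv_box_mem`); the transported class differs from the original by a
relation. [cite: DupontSah1982, §3] -/
theorem polyEnv_cusp_mem (k : ℕ) (L : Fin k → Fin 4 → ℝ) (hLalg : ∀ i c, IsAlgebraic ℚ (L i c))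
    (P : Set (Fin 3 → ℝ)) (hPpoly : KZ.IsGeodesicPolytope 2 P) (hP : P = {p | 0 < p 2 ∧ ∀ i, 0 < ∑ c, L i c * Ql p c})
    (hPne : P.Nonempty) (hND1 : ∀ i, ∃ p : Fin 3 → ℝ, 0 < p 2 ∧ ∑ c, L i c * Ql p c < 0)
    (hInt : IntegrableOn (fun p : Fin 3 → ℝ => 1 / p 2 ^ 3) P)
    (hCfin : Set.Finite {c : Fin 2 → ℝ | ∃ i j, i ≠ j ∧
        L i 0 * (c 0 ^ 2 + c 1 ^ 2) + L i 1 * c 0 + L i 2 * c 1 + L i 3 = 0 ∧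
        L j 0 * (c 0 ^ 2 + c 1 ^ 2) + L j 1 * c 0 + L j 2 * c 1 + L j 3 = 0})
    (n : Fin 2 → ℝ) (hnalg : ∀ l, IsAlgebraic ℚ (n l)) (ρ : ℝ) (hρ : 0 < ρ) (hρalg : IsAlgebraic ℚ ρ)
    (hsep : ∀ c₀ ∈ {c : Fin 2 → ℝ | ∃ i j, i ≠ j ∧
          L i 0 * (c 0 ^ 2 + c 1 ^ 2) + L i 1 * c 0 + L i 2 * c 1 + L i 3 = 0 ∧
          L j 0 * (c 0 ^ 2 + c 1 ^ 2) + L j 1 * c 0 + L j 2 * c 1 + L j 3 = 0},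
        c₀ ≠ n → (2 * ρ) ^ 2 < (c₀ 0 - n 0) ^ 2 + (c₀ 1 - n 1) ^ 2)
    (rn : KZ.IntegralRep 3) (hrnd : rn.domain = P ∩ {p | (p 0 - n 0) ^ 2 + (p 1 - n 1) ^ 2 + p 2 ^ 2 < ρ ^ 2})
    (hrni : EqOn rn.integrand (fun p => 1 / p 2 ^ 3) rn.domain) :
    KZ.of rn ∈ AddSubgroup.closure {x : KZ.FormalRep | ∃ (k : ℕ) (z : Fin k → ℂ) (e : Fin k → ℤ),
      (∀ i, IsAlgebraic ℚ (z i)) ∧ (∀ i, 0 < (z i).im) ∧ x - ∑ i, e i • KZ.of (ρ₀ (z i)) ∈ KZ.relations} := by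
  have hball : KZ.IsGeodesicPolytope 2 (P ∩ {p | (p 0 - n 0) ^ 2 + (p 1 - n 1) ^ 2 + p 2 ^ 2 < ρ ^ 2}) :=
    polyEnv_isGeodesicPolytope_inter_ball hPpoly n hnalg (ρ ^ 2) (hρalg.pow 2)
  have hbalg : ∀ i, IsAlgebraic ℚ ((![-n 0, -n 1] : Fin 2 → ℝ) i) := by
    intro i; fin_cases i
    · simpa using (hnalg 0).neg
    · simpa using (hnalg 1).neg
  obtain ⟨r'', -, hr''dom, hr''int, heq⟩ := polyEnv_transport hball ![-n 0, -n 1] hbalg rn hrnd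
    (fun p hp => hrni (hrnd ▸ hp))
  have hQint : IntegrableOn (fun p : Fin 3 → ℝ => 1 / p 2 ^ 3) r''.domain :=
    r''.integrableOn.congr_fun hr''int (KZ.IntegralRep.measurableSet_domain_holds r'')
  obtain ⟨M', δ', LQ, hM', hδ', hLQalg, hQnf, hQbox⟩ := polyEnv_image_boxed Ql hQl hClear k L hLalg P hP hPne hND1
    hInt hCfin n hnalg ρ hρ hρalg hsep r''.domain hr''dom hQint
  have henv : KZ.of r'' ∈ _ := polyEnv_box_mem Ql hQl Spx hSpx ρ₀ hρ₀ hMesh hCut (k + 1) LQ hLQalg r''.domain hQnf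
    M' δ' hM' hδ' hQbox r'' rfl hr''int
  have : KZ.of rn = (KZ.of rn - KZ.of r'') + KZ.of r'' := by abel
  rw [this]
  exact add_mem (polyEnv_relations_subset ρ₀ heq) henv

end Assembly2

/-- **STUB `stub_polytopeEnvelope`** (lead, skeleton v5 of line `odd-hyperbolic-ladder`): every representation of the
volume of a finite-volume `ℚ̄`-geodesic polytope of `ℍ³` lies in the Bloch–Wigner envelope (is, modulo the moves,
a `ℤ`-combination of ideal-tetrahedron classes). Normal form; floor candidates; a separating radius; cusp partition
(rule (1a)); the core is boxed by floor clearance, each cusp is boxed after a Möbius normalisation (rule (2));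
boxed normal-form pieces are meshed and cut into admissible simplices (rule (1a)), whose classes lead c2 put in the
envelope. [cite: DupontSah1982, §3] -/
theorem stub_polytopeEnvelope :
    ∀ (Ql : (Fin 3 → ℝ) → Fin 4 → ℝ) (hQl : ∀ p, Ql p = ![p 0 ^ 2 + p 1 ^ 2 + p 2 ^ 2, p 0, p 1, 1])
    (Spx : (Fin 4 → Fin 4 → ℝ) → Set (Fin 3 → ℝ))
    (hSpx : ∀ v, Spx v = {p | 0 < p 2 ∧ ∀ a, 0 < (Matrix.of v).det * ((Matrix.of v).updateRow a (Ql p)).det})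
    (ρ₀ : ℂ → KZ.IntegralRep 3)
    (hρ₀ : ∀ z, IsAlgebraic ℚ z → 0 < z.im →
      (ρ₀ z).domain = idealTetrahedron z ∧ EqOn (ρ₀ z).integrand (fun p => 1 / p 2 ^ 3) (idealTetrahedron z)),
    (∀ (P : Set (Fin 3 → ℝ)), KZ.IsGeodesicPolytope 2 P →
      P = ∅ ∨ ∃ (k : ℕ) (L : Fin k → Fin 4 → ℝ),
        (∀ i c, IsAlgebraic ℚ (L i c)) ∧
        P = {p | 0 < p 2 ∧ ∀ i, 0 < ∑ c, L i c * Ql p c} ∧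
        P.Nonempty ∧
        (∀ i, ∃ p : Fin 3 → ℝ, 0 < p 2 ∧ ∑ c, L i c * Ql p c < 0) ∧
        (∀ i j, i ≠ j → ∀ μ : ℝ, L i ≠ μ • L j) ∧
        (∀ i, L i 0 ≠ 0 ∨ L i 1 ≠ 0 ∨ L i 2 ≠ 0)) →
    (∀ (k : ℕ) (L : Fin k → Fin 4 → ℝ), (∀ i c, IsAlgebraic ℚ (L i c)) →
      (∀ i j, i ≠ j → ∀ μ : ℝ, L i ≠ μ • L j) → (∀ i, L i 0 ≠ 0 ∨ L i 1 ≠ 0 ∨ L i 2 ≠ 0) →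
      Set.Finite {n : Fin 2 → ℝ | ∃ i j, i ≠ j ∧
          L i 0 * (n 0 ^ 2 + n 1 ^ 2) + L i 1 * n 0 + L i 2 * n 1 + L i 3 = 0 ∧
          L j 0 * (n 0 ^ 2 + n 1 ^ 2) + L j 1 * n 0 + L j 2 * n 1 + L j 3 = 0} ∧
      (∀ n : Fin 2 → ℝ, (∃ i j, i ≠ j ∧
          L i 0 * (n 0 ^ 2 + n 1 ^ 2) + L i 1 * n 0 + L i 2 * n 1 + L i 3 = 0 ∧
          L j 0 * (n 0 ^ 2 + n 1 ^ 2) + L j 1 * n 0 + L j 2 * n 1 + L j 3 = 0) →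
          IsAlgebraic ℚ (n 0) ∧ IsAlgebraic ℚ (n 1))) →
    (∀ (k : ℕ) (L : Fin k → Fin 4 → ℝ) (P : Set (Fin 3 → ℝ)),
      P = {p | 0 < p 2 ∧ ∀ i, 0 < ∑ c, L i c * Ql p c} →
      ∀ (n : Fin 2 → ℝ),
      (∀ i, 0 < L i 0 * (n 0 ^ 2 + n 1 ^ 2) + L i 1 * n 0 + L i 2 * n 1 + L i 3 ∨
        (L i 0 * (n 0 ^ 2 + n 1 ^ 2) + L i 1 * n 0 + L i 2 * n 1 + L i 3 = 0 ∧
          (2 * L i 0 * n 0 + L i 1 ≠ 0 ∨ 2 * L i 0 * n 1 + L i 2 ≠ 0) ∧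
          ∀ j, j ≠ i → 0 < L j 0 * (n 0 ^ 2 + n 1 ^ 2) + L j 1 * n 0 + L j 2 * n 1 + L j 3)) →
      ¬ IntegrableOn (fun p : Fin 3 → ℝ => 1 / p 2 ^ 3) P) →
    (∀ (k : ℕ) (L : Fin k → Fin 4 → ℝ) (P : Set (Fin 3 → ℝ)),
      P = {p | 0 < p 2 ∧ ∀ i, 0 < ∑ c, L i c * Ql p c} → P.Nonempty →
      (∀ i, ∃ p : Fin 3 → ℝ, 0 < p 2 ∧ ∑ c, L i c * Ql p c < 0) →
      IntegrableOn (fun p : Fin 3 → ℝ => 1 / p 2 ^ 3) P →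
      (∃ M : ℝ, ∀ p ∈ P, p 0 ^ 2 + p 1 ^ 2 < M ^ 2) ∧
      (∀ η : ℝ, 0 < η → ∃ δ : ℝ, 0 < δ ∧ ∀ p ∈ P, p 2 < δ → ∃ n : Fin 2 → ℝ,
        (∃ i j, i ≠ j ∧ L i 0 * (n 0 ^ 2 + n 1 ^ 2) + L i 1 * n 0 + L i 2 * n 1 + L i 3 = 0 ∧
            L j 0 * (n 0 ^ 2 + n 1 ^ 2) + L j 1 * n 0 + L j 2 * n 1 + L j 3 = 0) ∧
        (p 0 - n 0) ^ 2 + (p 1 - n 1) ^ 2 < η ^ 2)) →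
    (∀ (M δ : ℝ), 0 < M → 0 < δ →
      ∃ (m : ℕ) (vs : Fin m → Fin 4 → Fin 4 → ℝ),
        (∀ j, (∀ i c, IsAlgebraic ℚ (vs j i c)) ∧
          (∀ i, vs j i 1 ^ 2 + vs j i 2 ^ 2 = vs j i 0 * vs j i 3 ∧ 0 ≤ vs j i 3 ∧ 0 < vs j i 0 + vs j i 3) ∧
          (Matrix.of (vs j)).det ≠ 0) ∧
        (∀ j j', j ≠ j' → Spx (vs j) ∩ Spx (vs j') = ∅) ∧
        volume ({p : Fin 3 → ℝ | p 0 ^ 2 + p 1 ^ 2 < M ^ 2 ∧ δ < p 2} \ ⋃ j, Spx (vs j)) = 0) →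
    (∀ (v : Fin 4 → Fin 4 → ℝ), ((∀ i c, IsAlgebraic ℚ (v i c)) ∧ (∀ i, (v i 1 ^ 2 + v i 2 ^ 2 = v i 0 * v i 3 ∧ 0 ≤ v i 3 ∧ 0 < v i 0 + v i 3) ∨ ∃ q : Fin 3 → ℝ, (∀ c, IsAlgebraic ℚ (q c)) ∧ 0 < q 2 ∧ v i = Ql q) ∧ (Matrix.of v).det ≠ 0) →
      ∀ (m : Fin 4 → ℝ), (∀ c, IsAlgebraic ℚ (m c)) →
      ∃ (N : ℕ) (ws : Fin N → Fin 4 → Fin 4 → ℝ),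
        (∀ j, (∀ i c, IsAlgebraic ℚ (ws j i c)) ∧ (∀ i, (ws j i 1 ^ 2 + ws j i 2 ^ 2 = ws j i 0 * ws j i 3 ∧ 0 ≤ ws j i 3 ∧ 0 < ws j i 0 + ws j i 3) ∨ ∃ q : Fin 3 → ℝ, (∀ c, IsAlgebraic ℚ (q c)) ∧ 0 < q 2 ∧ ws j i = Ql q) ∧ (Matrix.of (ws j)).det ≠ 0) ∧
        (∀ j, Spx (ws j) ⊆ Spx v ∩ {p | 0 < ∑ c, m c * Ql p c}) ∧
        (∀ j j', j ≠ j' → Spx (ws j) ∩ Spx (ws j') = ∅) ∧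
        volume ((Spx v ∩ {p | 0 < ∑ c, m c * Ql p c}) \ ⋃ j, Spx (ws j)) = 0) →
    ∀ (P : Set (Fin 3 → ℝ)), KZ.IsGeodesicPolytope 2 P →
    ∀ (r : KZ.IntegralRep 3), r.domain = P → EqOn r.integrand (fun p => 1 / p 2 ^ 3) P →
      KZ.of r ∈ AddSubgroup.closure {x : KZ.FormalRep | ∃ (k : ℕ) (z : Fin k → ℂ) (e : Fin k → ℤ),
        (∀ i, IsAlgebraic ℚ (z i)) ∧ (∀ i, 0 < (z i).im) ∧ x - ∑ i, e i • KZ.of (ρ₀ (z i)) ∈ KZ.relations} := by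
  intro Ql hQl Spx hSpx ρ₀ hρ₀ hNF hFin hDiv hClear hMesh hCut P hPpoly r hrd hri
  classical
  rcases hNF P hPpoly with hPe | ⟨k, L, hLalg, hP, hPne, hND1, hND2, hNZ⟩
  · exact polyEnv_relations_subset ρ₀ (KZ.of_mem_relations_of_volume_eq_zero r (by rw [hrd, hPe, measure_empty]))
  obtain ⟨hCfin, hCalg⟩ := hFin k L hLalg hND2 hNZ
  have hInt : IntegrableOn (fun p : Fin 3 → ℝ => 1 / p 2 ^ 3) P := by
    rw [← hrd]
    exact r.integrableOn.congr_fun (fun p hp => hri (hrd ▸ hp)) (KZ.IntegralRep.measurableSet_domain_holds r)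
  have hPsub : P ⊆ {p | 0 < p 2} := by
    rw [hP]; exact fun p hp => hp.1
  set CF := hCfin.toFinset with hCF
  have hCFalg : ∀ n ∈ CF, ∀ l, IsAlgebraic ℚ (n l) := fun n hn l => by
    have := hCalg n ((Finite.mem_toFinset hCfin).mp hn)
    fin_cases l
    · exact this.1
    · exact this.2
  obtain ⟨ρ, hρ, hρalg, hsepF⟩ := polyEnv_exists_radius CF
  /- the cusp partition -/
  obtain ⟨rrest, rn, hrestd, hresti, hrn, hrel⟩ := polyEnv_cusp_partition r CF hCFalg ρ hρ hρalg hsepF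
  /- the core piece is boxed -/
  obtain ⟨⟨M₀, hM₀⟩, hclP⟩ := hClear k L P hP hPne hND1 hInt
  obtain ⟨δ₀, hδ₀, hcl⟩ := hclP (ρ / 2) (by positivity)
  set e := CF.equivFin with he
  set ms : Fin (k + CF.card) → Fin 4 → ℝ := Fin.append L
    (fun j => ![1, -2 * (e.symm j).1 0, -2 * (e.symm j).1 1, (e.symm j).1 0 ^ 2 + (e.symm j).1 1 ^ 2 - ρ ^ 2])
    with hms
  have hmsalg : ∀ l c, IsAlgebraic ℚ (ms l c) := by
    intro l
    refine Fin.addCases (fun i => ?_) (fun j => ?_) l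
    · intro c
      simp only [hms, Fin.append_left]
      exact hLalg i c
    · intro c
      simp only [hms, Fin.append_right]
      have hn := hCFalg _ (e.symm j).2
      fin_cases c
      · simpa using isAlgebraic_one
      · simpa using ((isAlgebraic_nat 2).mul (hn 0)).neg
      · simpa using ((isAlgebraic_nat 2).mul (hn 1)).neg
      · simpa using (((hn 0).pow 2).add ((hn 1).pow 2)).sub (hρalg.pow 2)
  have hrest_nf : rrest.domain = {p | 0 < p 2 ∧ ∀ l, 0 < ∑ c, ms l c * Ql p c} := by
    rw [hrestd, hrd, hP]
    ext p
    simp only [mem_inter_iff, mem_setOf_eq]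
    constructor
    · rintro ⟨⟨hp2, hL⟩, hout⟩
      refine ⟨hp2, fun l => ?_⟩
      refine Fin.addCases (fun i => ?_) (fun j => ?_) l
      · simp only [hms, Fin.append_left]
        exact hL i
      · simp only [hms, Fin.append_right]
        rw [polyEnv_exterior_row Ql hQl]
        linarith [hout _ (e.symm j).2]
    · rintro ⟨hp2, hall⟩
      refine ⟨⟨hp2, fun i => ?_⟩, fun n hn => ?_⟩
      · have := hall (Fin.castAdd CF.card i)
        simpa only [hms, Fin.append_left] using this
      · have := hall (Fin.natAdd k (e ⟨n, hn⟩))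
        simp only [hms, Fin.append_right, Equiv.symm_apply_apply] at this
        rw [polyEnv_exterior_row Ql hQl] at this
        linarith
  have hrest_box : rrest.domain ⊆ {p | p 0 ^ 2 + p 1 ^ 2 < (|M₀| + 1) ^ 2 ∧ min δ₀ (ρ / 2) / 2 < p 2} := by
    intro p hp
    rw [hrestd, hrd] at hp
    obtain ⟨hpP, hout⟩ := hp
    refine ⟨?_, ?_⟩
    · have := hM₀ p hpP
      nlinarith [abs_nonneg M₀, sq_abs M₀]
    · by_contra hle
      push Not at hle
      have hm1 : min δ₀ (ρ / 2) ≤ δ₀ := min_le_left _ _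
      have hm2 : min δ₀ (ρ / 2) ≤ ρ / 2 := min_le_right _ _
      have hp2 : 0 < p 2 := hPsub hpP
      obtain ⟨n, hnC, hnear⟩ := hcl p hpP (by linarith)
      have hnCF : n ∈ CF := (Finite.mem_toFinset hCfin).mpr hnC
      have hfar := hout n hnCF
      nlinarith
  have hrest_mem : KZ.of rrest ∈ _ := polyEnv_box_mem Ql hQl Spx hSpx ρ₀ hρ₀ hMesh hCut (k + CF.card) ms hmsalg
    rrest.domain hrest_nf (|M₀| + 1) (min δ₀ (ρ / 2) / 2) (by positivity) (by positivity) hrest_box rrest rfl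
    (fun p hp => by
      rw [hresti]
      exact hri (by rw [hrestd, hrd] at hp; exact hp.1))
  /- the cusp pieces -/
  have hcusp_mem : ∀ n ∈ CF, KZ.of (rn n) ∈ AddSubgroup.closure {x : KZ.FormalRep |
      ∃ (k : ℕ) (z : Fin k → ℂ) (e : Fin k → ℤ),
      (∀ i, IsAlgebraic ℚ (z i)) ∧ (∀ i, 0 < (z i).im) ∧ x - ∑ i, e i • KZ.of (ρ₀ (z i)) ∈ KZ.relations} := by
    intro n hn
    obtain ⟨hrnd, hrni⟩ := hrn n hn
    refine polyEnv_cusp_mem Ql hQl Spx hSpx ρ₀ hρ₀ hClear hMesh hCut k L hLalg P hPpoly hP hPne hND1 hInt hCfin n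
      (hCFalg n hn) ρ hρ hρalg (fun c₀ hc₀ hne => ?_) (rn n) (by rw [hrnd, hrd]) (fun p hp => ?_)
    · exact hsepF c₀ ((Finite.mem_toFinset hCfin).mpr hc₀) n hn hne
    · rw [hrni]
      exact hri (by rw [hrnd, hrd] at hp; exact hp.1)
  /- assembly -/
  have : KZ.of r = (KZ.of r - KZ.of rrest - ∑ n ∈ CF, KZ.of (rn n)) + KZ.of rrest + ∑ n ∈ CF, KZ.of (rn n) := by
    abel
  rw [this]
  exact add_mem (add_mem (polyEnv_relations_subset ρ₀ hrel) hrest_mem) (sum_mem fun n hn => hcusp_mem n hn)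


end Summit.KontsevichZagierPeriods.HyperbolicBloch.OffTetraSectorKernel

end
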